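import Literature.Probability.LatticeModels.MedialExplorationEscapeWinding
import HarnessLib

/-!
# Escape along a lattice vertex path: the winding of the exploration at a boundary dart from the turning
# of a vertex path back to the start corner

Topic `Literature/Probability/LatticeModels`; fourth instalment after `MedialCornerTrailWinding.lean`,
`MedialExplorationPrefixWinding.lean`, `MedialExplorationEscapeWinding.lean` (escape paths: the winding at a
corner with an escape path is deterministic) and `MedialCornerWalk.lean` (corner walks of lattice paths). Here
the escape path of a corner `q = (u, j)` is the corner walk of a LATTICE VERTEX PATH from `u` back to the vertex
`x₀` of the start corner `(x₀, k₀) = startCorner hD`: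

* the path leaves `u` along its `(j+1)`-st edge (so that no other corner at `u` is used), runs through
  FORBIDDEN VERTICES — sites on the dual-wired arc `B`, or sites none of whose four faces is inner (e.g. sites
  outside the discrete domain) — pairwise distinct and distinct from `u, x₀`, and enters `x₀` along the
  direction `k₀ + 1`, i.e. through the non-inner face across the start edge `e_a`;
* `vertexEscape_isEscape` — its corner walk, completed by the corner `(x₀, k₀ + 3)` of that face, is an
  escape path of `q` with escape sum `walkTurns j ds + 1` (the signed turns of the vertex path, vertex by
  vertex, plus the final left turn into the start corner);
* **`turnCount_eq_of_vertexEscape_top_east`** (and `…_west_north`, `…_east_south`, `…_bot_west`) — if some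
  corner of the walk points east (face index `3`) and lies weakly above, in medial coordinates, every corner
  with an inner face and every corner of the walk, then at every passage of `q` before the exit
  `turnCount = -4 - (walkTurns j ds + 1)`, for every configuration (and the three rotated variants).

For a touch site `u` of a straight free side this is Duminil-Copin's "the winding at a boundary edge is
deterministic" with the escape running just outside the domain back to `e_a`; the value is the net turning of
the vertex path. Everything is proved.

## References

* H. Duminil-Copin, C. Hongler, P. Nolin, Comm. Pure Appl. Math. 64 (2011), Lemma 12.
  [DuminilCopinHonglerNolin2011]
* S. Smirnov, C. R. Acad. Sci. Paris 333 (2001), §2. [Smirnov2001]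
-/

namespace Literature.Probability.LatticeModels

open MedialTrail Finset DiscreteDobrushin

variable {D : DiscreteDobrushin}

/-! ### The completed corner walk of a vertex escape -/

/-- `k + 3 + 1 = k` and `k + 1 + 2 = k + 3` in `Fin 4`. [folklore] -/
theorem fin4_escape_arith (k : Fin 4) : k + 3 + 1 = k ∧ k + 1 + 2 = k + 3 := by revert k; decide

/-- The corner walk leaving `u` along its `(j+1)`-st edge starts with the single corner `(u, j)`.
[cite: Smirnov2010, §4] -/
theorem cornerWalk_cons_succ (u : Site 2) (j : Fin 4) (ds : List (Fin 4)) :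
    cornerWalk u j ((j + 1) :: ds) = (u, j) :: cornerWalk (u + cornerUnit (j + 1)) (j + 3) ds := by
  rw [cornerWalk_cons]
  have h0 : ∀ j : Fin 4, (j + 1 + 3 - j).val = 0 := by decide
  have h3 : ∀ j : Fin 4, j + 1 + 2 = j + 3 := by decide
  rw [h0, h3]
  rfl

/-- A nonempty direction list splits off its last direction. [folklore] -/
theorem eq_dropLast_append_lastDir {ds : List (Fin 4)} (hds : ds ≠ []) : ds = ds.dropLast ++ [lastDir ds] := by
  rw [lastDir, List.getLastD_eq_getLast?, List.getLast?_eq_some_getLast hds, Option.getD_some]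
  exact (List.dropLast_append_getLast hds).symm

/-- The ESCAPE LIST of the vertex path from `u` with directions `ds` back to the start vertex `x₀`: its corner
walk entered at `j`, completed by the corner `(x₀, k₀ + 3)` of the non-inner face across the start edge.
[cite: DuminilCopinHonglerNolin2011, Lemma 12] -/
noncomputable def escapeList (hD : D.IsZdAdmissible) (u : Site 2) (j : Fin 4) (ds : List (Fin 4)) : List (Site 2 × Fin 4) :=
  cornerWalk u j ds ++ [((startCorner hD).1, (startCorner hD).2 + 3)]

section Main

variable (hD : D.IsZdAdmissible) {u : Site 2} {j : Fin 4} {ds : List (Fin 4)}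

/-- **A vertex escape is an escape path.** Hypotheses: the path leaves `u` along its `(j+1)`-st edge, ends at
the start vertex `x₀` arriving along `k₀ + 1`, its vertices after `u` are forbidden (on `B`, or with no inner
face around), and `u`, the later vertices and `x₀` are pairwise distinct. Conclusion: the escape list is an
escape path of `(u, j)` with escape sum `walkTurns j ds + 1`. [cite: DuminilCopinHonglerNolin2011, Lemma 12] -/
theorem vertexEscape_isEscape (hhead : ds.head? = some (j + 1)) (hend : pathEnd u ds = (startCorner hD).1)
    (hlast : lastDir ds = (startCorner hD).2 + 1)
    (hforb : ∀ v ∈ (pathVerts u ds).tail, (∀ i : Fin 4, ¬ D.IsInnerFace (faceAt v i)) ∨ v ∈ D.zdArcB)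
    (hnodup : (pathVerts u ds ++ [(startCorner hD).1]).Nodup) :
    IsEscape D hD (u, j) (fun i => (escapeList hD u j ds).getD i (startCorner hD)) ((escapeList hD u j ds).length - 2) ∧
      escapeSum (fun i => (escapeList hD u j ds).getD i (startCorner hD)) ((escapeList hD u j ds).length - 2) =
        walkTurns j ds + 1 := by
  set p₁ : Site 2 × Fin 4 := ((startCorner hD).1, (startCorner hD).2 + 3) with hp₁
  have hds : ds ≠ [] := by rintro rfl; simp at hhead
  obtain ⟨ds', hds'⟩ : ∃ ds', ds = (j + 1) :: ds' := by
    obtain ⟨d, ds', rfl⟩ := List.exists_cons_of_ne_nil hds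
    simp only [List.head?_cons, Option.some.injEq] at hhead
    exact ⟨ds', by rw [hhead]⟩
  have hW : cornerWalk u j ds = (u, j) :: cornerWalk (u + cornerUnit (j + 1)) (j + 3) ds' := by
    rw [hds', cornerWalk_cons_succ]
  have hL : escapeList hD u j ds = cornerWalk u j ds ++ [p₁] := rfl
  have hlen2 : (escapeList hD u j ds).length = ((escapeList hD u j ds).length - 2) + 2 := by
    rw [hL, List.length_append, hW]; simp
  -- the arrival corner at the end vertex is `p₁`
  have harr : (pathEnd u ds, lastDir ds + 2) = p₁ := by
    rw [hend, hlast, hp₁, (fin4_escape_arith (startCorner hD).2).2]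
  have hc₀succ : startCorner hD = leftSucc p₁ := by
    rw [hp₁, leftSucc, (fin4_escape_arith (startCorner hD).2).1]
  -- the escape-path clauses
  have hEsc := IsEscape.of_list (hD := hD) (q := (u, j)) (escapeList hD u j ds) hlen2
    (by rw [hL, List.head?_append, head?_cornerWalk _ _ hds]; rfl)
    (by
      rw [hL]
      refine List.IsChain.append (isChain_cornerWalk u j ds) (List.isChain_singleton _) fun x hx y hy => ?_
      simp only [List.head?_cons, Option.mem_def, Option.some.injEq] at hy
      subst hy
      rw [Option.mem_def, List.getLast?_eq_some_getLast (cornerWalk_ne_nil u j hds), Option.some.injEq] at hx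
      subst hx
      rw [← harr]
      have key := isSucc_getLast_cornerWalk u j ds.dropLast (lastDir ds)
      have heq : ds.dropLast ++ [lastDir ds] = ds := (eq_dropLast_append_lastDir hds).symm
      simp only [heq] at key
      exact key)
    (by
      rw [hc₀succ]
      simp only [hL, List.getLast_append_of_ne_nil _ (List.cons_ne_nil _ _), List.getLast_singleton]
      exact Or.inl rfl)
    (by
      intro d hd
      rw [hL, hW, List.cons_append, List.tail_cons, List.mem_append, List.mem_singleton] at hd
      rcases hd with hd | rfl
      · have hv : d.1 ∈ (pathVerts u ds).tail := by
          rw [hds', pathVerts, List.tail_cons]; exact fst_mem_pathVerts hd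
        rcases hforb d.1 hv with h | h
        · exact Or.inl (h d.2)
        · exact Or.inr h
      · exact Or.inl (isStartCorner_startCorner hD).isOutEdge.2)
    (by
      rw [hL]
      refine List.Nodup.append (nodup_cornerWalk (List.nodup_append.1 hnodup).1) (List.nodup_singleton _)
        fun d hd hd' => ?_
      rw [List.mem_singleton] at hd'
      subst hd'
      have h1 : (startCorner hD).1 ∈ pathVerts u ds := by simpa [hp₁] using fst_mem_pathVerts hd
      exact (List.nodup_append.1 hnodup).2.2 _ h1 _ (List.mem_singleton_self _) rfl)
  refine ⟨hEsc.1, ?_⟩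
  rw [hEsc.2, hL, walkSign_append _ p₁ rfl, ← harr, walkSign_cornerWalk u j hds, harr, walkSign, hc₀succ, sgn_leftSucc]

/-- Corners of the escape list are values of the escape sequence at indices `≤ length - 1`. [folklore] -/
theorem exists_index_of_mem_escapeList {d : Site 2 × Fin 4} (hd : d ∈ escapeList hD u j ds) :
    ∃ m ≤ (escapeList hD u j ds).length - 2 + 1, (escapeList hD u j ds).getD m (startCorner hD) = d := by
  obtain ⟨i, hi, rfl⟩ := List.mem_iff_getElem.1 hd
  exact ⟨i, by omega, List.getD_eq_getElem _ _ hi⟩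

/-- Values of the escape sequence at indices `≤ length - 1` are corners of the escape list. [folklore] -/
theorem getD_mem_escapeList (hds : ds ≠ []) {m : ℕ} (hm : m ≤ (escapeList hD u j ds).length - 2 + 1) :
    (escapeList hD u j ds).getD m (startCorner hD) ∈ escapeList hD u j ds := by
  have hlen : 2 ≤ (escapeList hD u j ds).length := by
    unfold escapeList
    rw [List.length_append, List.length_singleton]
    have := List.length_pos_of_ne_nil (cornerWalk_ne_nil u j hds)
    omega
  rw [List.getD_eq_getElem _ _ (by omega)]
  exact List.getElem_mem _

/-- **The winding at a corner with a vertex escape, topmost eastward walk corner.** If some corner `d` of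
the escape list points east (face index `3`) and lies weakly above (medial second coordinate) every corner
with an inner face and every corner of the escape list, then at every passage of `(u, j)` before the exit the
turn count of the exploration is `-4 - (walkTurns j ds + 1)`. [cite: DuminilCopinHonglerNolin2011, Lemma 12] -/
theorem turnCount_eq_of_vertexEscape_top_east (hhead : ds.head? = some (j + 1))
    (hend : pathEnd u ds = (startCorner hD).1) (hlast : lastDir ds = (startCorner hD).2 + 1)
    (hforb : ∀ v ∈ (pathVerts u ds).tail, (∀ i : Fin 4, ¬ D.IsInnerFace (faceAt v i)) ∨ v ∈ D.zdArcB)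
    (hnodup : (pathVerts u ds ++ [(startCorner hD).1]).Nodup)
    {d : Site 2 × Fin 4} (hd : d ∈ escapeList hD u j ds) (h3 : d.2 = 3)
    (htopI : ∀ p : Site 2 × Fin 4, D.IsInnerFace (cFace p) → (cpos p).2 ≤ (cpos d).2)
    (htopE : ∀ d' ∈ escapeList hD u j ds, (cpos d').2 ≤ (cpos d).2)
    (ω : Percolation.BondConfig (Site 2)) {t : ℕ} (ht : t < exitTime hD ω)
    (horb : cornerOrbit (D.bcBondConfig ω) (startCorner hD) t = (u, j)) :
    turnCount (D.bcBondConfig ω) (startCorner hD) t = -4 - (walkTurns j ds + 1) := by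
  have hds : ds ≠ [] := by rintro rfl; simp at hhead
  obtain ⟨hE, hsum⟩ := vertexEscape_isEscape hD hhead hend hlast hforb hnodup
  obtain ⟨m₀, hm₀, hm₀d⟩ := exists_index_of_mem_escapeList hD hd
  rw [← hsum]
  refine hE.turnCount_eq_of_top_east hm₀ (by rw [hm₀d]; exact h3) (fun p hp => by rw [hm₀d]; exact htopI p hp)
    (fun m hm => by rw [hm₀d]; exact htopE _ (getD_mem_escapeList hD hds hm)) ω ht horb

/-- **The winding at a corner with a vertex escape, westmost northward walk corner** (face index `0`).
[cite: DuminilCopinHonglerNolin2011, Lemma 12] -/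
theorem turnCount_eq_of_vertexEscape_west_north (hhead : ds.head? = some (j + 1))
    (hend : pathEnd u ds = (startCorner hD).1) (hlast : lastDir ds = (startCorner hD).2 + 1)
    (hforb : ∀ v ∈ (pathVerts u ds).tail, (∀ i : Fin 4, ¬ D.IsInnerFace (faceAt v i)) ∨ v ∈ D.zdArcB)
    (hnodup : (pathVerts u ds ++ [(startCorner hD).1]).Nodup)
    {d : Site 2 × Fin 4} (hd : d ∈ escapeList hD u j ds) (h0 : d.2 = 0)
    (hwestI : ∀ p : Site 2 × Fin 4, D.IsInnerFace (cFace p) → (cpos d).1 ≤ (cpos p).1)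
    (hwestE : ∀ d' ∈ escapeList hD u j ds, (cpos d).1 ≤ (cpos d').1)
    (ω : Percolation.BondConfig (Site 2)) {t : ℕ} (ht : t < exitTime hD ω)
    (horb : cornerOrbit (D.bcBondConfig ω) (startCorner hD) t = (u, j)) :
    turnCount (D.bcBondConfig ω) (startCorner hD) t = -4 - (walkTurns j ds + 1) := by
  have hds : ds ≠ [] := by rintro rfl; simp at hhead
  obtain ⟨hE, hsum⟩ := vertexEscape_isEscape hD hhead hend hlast hforb hnodup
  obtain ⟨m₀, hm₀, hm₀d⟩ := exists_index_of_mem_escapeList hD hd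
  rw [← hsum]
  refine hE.turnCount_eq_of_west_north hm₀ (by rw [hm₀d]; exact h0) (fun p hp => by rw [hm₀d]; exact hwestI p hp)
    (fun m hm => by rw [hm₀d]; exact hwestE _ (getD_mem_escapeList hD hds hm)) ω ht horb

/-- **The winding at a corner with a vertex escape, eastmost southward walk corner** (face index `2`).
[cite: DuminilCopinHonglerNolin2011, Lemma 12] -/
theorem turnCount_eq_of_vertexEscape_east_south (hhead : ds.head? = some (j + 1))
    (hend : pathEnd u ds = (startCorner hD).1) (hlast : lastDir ds = (startCorner hD).2 + 1)
    (hforb : ∀ v ∈ (pathVerts u ds).tail, (∀ i : Fin 4, ¬ D.IsInnerFace (faceAt v i)) ∨ v ∈ D.zdArcB)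
    (hnodup : (pathVerts u ds ++ [(startCorner hD).1]).Nodup)
    {d : Site 2 × Fin 4} (hd : d ∈ escapeList hD u j ds) (h2 : d.2 = 2)
    (heastI : ∀ p : Site 2 × Fin 4, D.IsInnerFace (cFace p) → (cpos p).1 ≤ (cpos d).1)
    (heastE : ∀ d' ∈ escapeList hD u j ds, (cpos d').1 ≤ (cpos d).1)
    (ω : Percolation.BondConfig (Site 2)) {t : ℕ} (ht : t < exitTime hD ω)
    (horb : cornerOrbit (D.bcBondConfig ω) (startCorner hD) t = (u, j)) :
    turnCount (D.bcBondConfig ω) (startCorner hD) t = -4 - (walkTurns j ds + 1) := by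
  have hds : ds ≠ [] := by rintro rfl; simp at hhead
  obtain ⟨hE, hsum⟩ := vertexEscape_isEscape hD hhead hend hlast hforb hnodup
  obtain ⟨m₀, hm₀, hm₀d⟩ := exists_index_of_mem_escapeList hD hd
  rw [← hsum]
  refine hE.turnCount_eq_of_east_south hm₀ (by rw [hm₀d]; exact h2) (fun p hp => by rw [hm₀d]; exact heastI p hp)
    (fun m hm => by rw [hm₀d]; exact heastE _ (getD_mem_escapeList hD hds hm)) ω ht horb

/-- **The winding at a corner with a vertex escape, bottommost westward walk corner** (face index `1`).
[cite: DuminilCopinHonglerNolin2011, Lemma 12] -/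
theorem turnCount_eq_of_vertexEscape_bot_west (hhead : ds.head? = some (j + 1))
    (hend : pathEnd u ds = (startCorner hD).1) (hlast : lastDir ds = (startCorner hD).2 + 1)
    (hforb : ∀ v ∈ (pathVerts u ds).tail, (∀ i : Fin 4, ¬ D.IsInnerFace (faceAt v i)) ∨ v ∈ D.zdArcB)
    (hnodup : (pathVerts u ds ++ [(startCorner hD).1]).Nodup)
    {d : Site 2 × Fin 4} (hd : d ∈ escapeList hD u j ds) (h1 : d.2 = 1)
    (hbotI : ∀ p : Site 2 × Fin 4, D.IsInnerFace (cFace p) → (cpos d).2 ≤ (cpos p).2)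
    (hbotE : ∀ d' ∈ escapeList hD u j ds, (cpos d).2 ≤ (cpos d').2)
    (ω : Percolation.BondConfig (Site 2)) {t : ℕ} (ht : t < exitTime hD ω)
    (horb : cornerOrbit (D.bcBondConfig ω) (startCorner hD) t = (u, j)) :
    turnCount (D.bcBondConfig ω) (startCorner hD) t = -4 - (walkTurns j ds + 1) := by
  have hds : ds ≠ [] := by rintro rfl; simp at hhead
  obtain ⟨hE, hsum⟩ := vertexEscape_isEscape hD hhead hend hlast hforb hnodup
  obtain ⟨m₀, hm₀, hm₀d⟩ := exists_index_of_mem_escapeList hD hd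
  rw [← hsum]
  refine hE.turnCount_eq_of_bot_west hm₀ (by rw [hm₀d]; exact h1) (fun p hp => by rw [hm₀d]; exact hbotI p hp)
    (fun m hm => by rw [hm₀d]; exact hbotE _ (getD_mem_escapeList hD hds hm)) ω ht horb

end Main

end Literature.Probability.LatticeModels
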